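import Mathlib
import Literature.Analysis.FluidPDE.Tao2016AveragedNS.ShiftSetCascadeFlows
import Literature.Analysis.FluidPDE.Tao2016AveragedNS.ShiftSetCascadeFlux
import Summits.NavierStokesRegularity.NavierStokesRegularity.Theorems.TaoLadderRungTwoFlatQuadPolarOn
import Summits.NavierStokesRegularity.NavierStokesRegularity.Theorems.TaoLadderRungTwoFlatLinearisedUniqueness
import Summits.NavierStokesRegularity.NavierStokesRegularity.Theorems.TaoLadderRungTwoFlatForcedGronwall
import Summits.NavierStokesRegularity.NavierStokesRegularity.Theorems.TaoLadderRungTwoFlatVariationalExistence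
import Summits.NavierStokesRegularity.NavierStokesRegularity.Theorems.TaoLadderRungTwoFlatGaugeGronwall
import Summits.NavierStokesRegularity.NavierStokesRegularity.Theorems.TaoLadderRungTwoFlatNonlinearHop
import Summits.NavierStokesRegularity.NavierStokesRegularity.Theorems.TaoLadderRungTwoFlatLinearisedPersistence
import Summits.NavierStokesRegularity.NavierStokesRegularity.Theorems.TaoLadderRungTwoFlatGaugeGronwallOn
import HarnessLib

/-!
# PERSISTENCE of the linearised hop contraction — WINDOW FORM (perturbed reference and its variational solutions on
  `[0, T]` only; the unperturbed reference global, e.g. the λ₀ = 1 pulse)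
  (helper for item stmt-NavierStokesRegularity-22987 `FlatGapCertificatesV2`, crux K_A♭ of route TaoLadderRungTwoFlat;
  cell harvest/h2-tao-ladder, p1 g20 — window version of `…LinearisedPersistence.linHop_persistence`, lemma L4 (linear
  part) of the analytic lane on certificate windows: the graded reference (renormalised frame) exists only up to blow-up)

* `linHop_persistence_Icc` — `hlin(W, α)` in the GLOBAL form produced by (S2)/`HopContractionWith` (all bounded
  variational solutions along the global reference `W`) ⟹ `hlin(W', α')` in the WINDOW form (variational solutions
  continuous on `Icc 0 T`, `HasDerivAt` on `Ioo 0 T`, sup-bounded) for a WINDOW solution `W'` of the `α'`-lattice,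
  with `(ρ + δ, C)` and the same explicit `δ` as the global version.

HONEST FRAMING: elementary perturbation theory for MODEL lattices; nothing certified; nothing about the Navier–Stokes
equations.
-/

noncomputable section

-- the sub-problem namespace repeats the summit name by design (D-0017)
set_option linter.dupNamespace false

namespace Summit.NavierStokesRegularity.NavierStokesRegularity.Theorems

open Set Filter Literature.Analysis.FluidPDE Literature.Analysis.FluidPDE.TaoCascade
open scoped Topology Nat

namespace QuadPolar

variable {m : ℕ}

/-- **PERSISTENCE OF THE LINEARISED HOP CONTRACTION, WINDOW FORM** (reference `W` global — e.g. the pulse —, perturbed reference `W'` and its variational solutions on the window `[0, T]` only) under perturbation of the table (`‖α' − α‖₁ ≤ η`) and of the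
reference solution (`|W' − W| ≤ δ_D` on `[0, T]`, `ν|W'(T) − W(T)| ≤ Δ`, `ν|W'| ≤ M_ν` on `[0, T]`, read-out gauge
`ν_{i,j} = ω_{i,j−N}`): if `hlin(W, α)` holds with `(ρ, C)` for all `B`, then `hlin(W', α')` holds with
`(ρ + δ, C)`, `δ = Γ'·2Λ(ηM + ‖α‖₁δ_D)·e^{L″T}·T·e^{L'T} + C·(ηMΛM_ν + (2‖α‖₁MΛ + 1)Δ)`, `L' = 2‖α‖₁MΛ`, `L″ = 2‖α'‖₁MΛ`
— the linear contraction modulo the neutral directions is an open condition, with explicit modulus.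
[cite: Tao2016AveragedNS, §4 (4.8) and §6.3–6.4 (statement shape); route TaoLadderRungTwoFlat, analytic lane L4 (linear part)] -/
theorem linHop_persistence_Icc {𝕊 : Finset (ℤ × ℤ × ℤ)} (h𝕊 : IsNearestNeighbourSet 𝕊)
    (α α' : Fin m → Fin m → Fin m → ℤ × ℤ × ℤ → ℝ) {ω : Fin m → ℤ → ℝ} {Λ Γ' : ℝ} (hω : IsWindowRegular ω Λ)
    {N : ℤ} (hΓ' : ∀ i j, ω i (j - N) ≤ Γ' * ω i j)
    {W W' : Fin m → ℤ → ℝ → ℝ} {M Mν δD Δ η T ρ C : ℝ} (hT : 0 ≤ T)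
    (hW : ∀ i n t, HasDerivAt (W i n) (quadTermOn 𝕊 0 α W i n t) t)
    (hW'c : ∀ i n, ContinuousOn (W' i n) (Icc 0 T))
    (hWb : ∀ i n t, |W i n t| ≤ M) (hW'b : ∀ i n, ∀ t ∈ Icc 0 T, |W' i n t| ≤ M) (hMν : 0 ≤ Mν)
    (hW'g : ∀ i j, ∀ t ∈ Icc 0 T, ω i (j - N) * |W' i j t| ≤ Mν)
    (hδD : ∀ i j, ∀ t ∈ Icc 0 T, |W' i j t - W i j t| ≤ δD)
    (hΔ : ∀ i j, ω i (j - N) * |W' i j T - W i j T| ≤ Δ) (hη : tableAbsSum 𝕊 (α' - α) ≤ η)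
    (hlin : ∀ (u : Fin m → ℤ → ℝ → ℝ) (B : ℝ), (∀ i n t, HasDerivAt (u i n) (linTermOn 𝕊 0 α W u i n t) t) →
      (∃ Mu : ℝ, ∀ i n, ∀ t ∈ Icc 0 T, |u i n t| ≤ Mu) → (∀ i k, ω i k * |u i k 0| ≤ B) →
        ∃ c₁ c₂ : ℝ, |c₁| ≤ C * B ∧ |c₂| ≤ C * B ∧
          ∀ i k, ω i k * |u i (k + N) T - c₁ * quadTermOn 𝕊 0 α W i (k + N) T - c₂ * W i (k + N) T| ≤ ρ * B) :
    ∀ (u' : Fin m → ℤ → ℝ → ℝ) (B : ℝ), (∀ i n, ContinuousOn (u' i n) (Icc 0 T)) →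
      (∀ i n, ∀ t ∈ Ioo 0 T, HasDerivAt (u' i n) (linTermOn 𝕊 0 α' W' u' i n t) t) →
      (∃ Mu : ℝ, ∀ i n, ∀ t ∈ Icc 0 T, |u' i n t| ≤ Mu) → (∀ i k, ω i k * |u' i k 0| ≤ B) →
        ∃ c₁ c₂ : ℝ, |c₁| ≤ C * B ∧ |c₂| ≤ C * B ∧
          ∀ i k, ω i k * |u' i (k + N) T - c₁ * quadTermOn 𝕊 0 α' W' i (k + N) T - c₂ * W' i (k + N) T| ≤
            (ρ + (Γ' * (2 * Λ * (η * M + tableAbsSum 𝕊 α * δD)) * Real.exp (2 * tableAbsSum 𝕊 α' * M * Λ * T) * T *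
              Real.exp (2 * tableAbsSum 𝕊 α * M * Λ * T) +
              C * (η * M * Λ * Mν + (2 * tableAbsSum 𝕊 α * M * Λ + 1) * Δ))) * B := by
  intro u' B hu'c hu' hub' hBu'
  obtain ⟨Mu', hMu'⟩ := hub'
  set ν : Fin m → ℤ → ℝ := fun i j => ω i (j - N) with hν
  have hνreg : IsWindowRegular ν Λ := hω.shift N
  have hA := tableAbsSum_nonneg 𝕊 α
  have hA' := tableAbsSum_nonneg 𝕊 α'
  have hAd := tableAbsSum_nonneg 𝕊 (α' - α)
  have hΛ : 0 ≤ Λ := le_trans zero_le_one hω.2.1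
  -- the comparison variational solution along (W, α) from the same data
  have hM0 : 0 ≤ max M 0 := le_max_right _ _
  have hWbm : ∀ j k t, |W j k t| ≤ max M 0 := fun j k t => (hWb j k t).trans (le_max_left _ _)
  have hlipW : ∀ j k t s, |W j k t - W j k s| ≤ tableAbsSum 𝕊 α * (max M 0) ^ 2 * |t - s| :=
    lipschitz_time_of_globalSol 𝕊 α hW hWbm
  have hd0 : ∀ i k, |(fun i k => u' i k 0) i k| ≤ max Mu' 0 := fun i k =>
    (hMu' i k 0 ⟨le_rfl, hT⟩).trans (le_max_left _ _)
  obtain ⟨u, hu0, hud, hub⟩ := exists_linearised_solution 𝕊 α hWbm hM0 (by positivity) hlipW hd0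
  have hubT : ∀ i n, ∀ t ∈ Icc 0 T,
      |u i n t| ≤ max Mu' 0 * Real.exp (2 * tableAbsSum 𝕊 α * max M 0 * T) :=
    fun i n t ht => hub T hT i n t ⟨by linarith [ht.1], ht.2⟩
  obtain ⟨c₁, c₂, hc₁, hc₂, hlinu⟩ := hlin u B hud ⟨_, hubT⟩ (fun i k => by rw [hu0]; exact hBu' i k)
  refine ⟨c₁, c₂, hc₁, hc₂, fun i k => ?_⟩
  -- positivity facts available now that a species `i` is at hand
  have hωpos := hω.1
  have hB0 : 0 ≤ B := le_trans (mul_nonneg (hωpos i k).le (abs_nonneg _)) (hBu' i k)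
  have hΓ'0 : 0 ≤ Γ' := by
    have h := hΓ' i k
    have h1 : 0 < ω i (k - N) := hωpos i (k - N)
    by_contra hneg
    push Not at hneg
    have : Γ' * ω i k < 0 := mul_neg_of_neg_of_pos hneg (hωpos i k)
    linarith
  have hM : 0 ≤ M := (abs_nonneg _).trans (hWb i k 0)
  have hC0 : 0 ≤ C * B := (abs_nonneg _).trans hc₁
  have hη0 : 0 ≤ η := hAd.trans hη
  have hδD0 : 0 ≤ δD := (abs_nonneg _).trans (hδD i k 0 ⟨le_rfl, hT⟩)
  have hΔ0 : 0 ≤ Δ := le_trans (mul_nonneg (hωpos i (k + N - N)).le (abs_nonneg _)) (hΔ i (k + N))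
  -- (1) ν-gauge bound of u' on [0, T]
  set L'' : ℝ := 2 * tableAbsSum 𝕊 α' * M * Λ with hL''
  set mstar : ℝ := Γ' * B * Real.exp (L'' * T) with hmstar
  have hmstar0 : 0 ≤ mstar := by rw [hmstar]; positivity
  have hWc : ∀ j l, Continuous (W j l) := fun j l => continuous_iff_continuousAt.2 fun t => (hW j l t).continuousAt
  have hu'ν0 : ∀ j l, ν j l * |u' j l 0| ≤ Γ' * B := fun j l => by
    show ω j (l - N) * |u' j l 0| ≤ Γ' * B
    calc ω j (l - N) * |u' j l 0| ≤ Γ' * ω j l * |u' j l 0| :=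
          mul_le_mul_of_nonneg_right (hΓ' j l) (abs_nonneg _)
      _ = Γ' * (ω j l * |u' j l 0|) := by ring
      _ ≤ Γ' * B := mul_le_mul_of_nonneg_left (hBu' j l) hΓ'0
  have hu'ν : ∀ j l, ∀ s ∈ Icc 0 T, ν j l * |u' j l s| ≤ mstar := by
    intro j l s hs
    have h := gauge_abs_le_exp_Icc h𝕊 α' hνreg hW'c hW'b hu'c hu' hMu' hu'ν0 j l hs
    have hmono : Real.exp (2 * tableAbsSum 𝕊 α' * M * Λ * s) ≤ Real.exp (L'' * T) := by
      rw [hL'']; exact Real.exp_le_exp.mpr (mul_le_mul_of_nonneg_left hs.2 (by positivity))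
    calc ν j l * |u' j l s| ≤ Γ' * B * Real.exp (2 * tableAbsSum 𝕊 α' * M * Λ * s) := h
      _ ≤ mstar := by rw [hmstar]; exact mul_le_mul_of_nonneg_left hmono (by positivity)
  -- (2) the difference e = u' − u solves the forced equation along (W, α)
  set e : Fin m → ℤ → ℝ → ℝ := fun j l s => u' j l s - u j l s with he
  set f : Fin m → ℤ → ℝ → ℝ := fun j l s => linTermOn 𝕊 0 α' W' u' j l s - linTermOn 𝕊 0 α W u' j l s with hf
  have hWcOn : ∀ j l, ContinuousOn (W j l) (Icc 0 T) := fun j l => (hWc j l).continuousOn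
  have hfc : ∀ j l, ContinuousOn (f j l) (Icc 0 T) := fun j l =>
    (continuousOn_linTermOn 𝕊 0 α' hW'c hu'c j l).sub (continuousOn_linTermOn 𝕊 0 α hWcOn hu'c j l)
  set F : ℝ := 2 * Λ * (η * M + tableAbsSum 𝕊 α * δD) * mstar with hF
  have hF0 : 0 ≤ F := by rw [hF]; positivity
  have hff : ∀ j l, ∀ s ∈ Icc 0 T, ν j l * |f j l s| ≤ F := by
    intro j l s hs
    -- f = Lin_{α'−α, W'}(u') + Lin_{α, W'−W}(u')
    have ef : f j l s = linTermOn 𝕊 0 (α' - α) W' u' j l s + linTermOn 𝕊 0 α (W' - W) u' j l s := by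
      rw [hf, ← linTermOn_sub_table, ← linTermOn_sub_background]; ring
    have h1 := gauge_abs_linTermOn_le_of_sup h𝕊 (α' - α) hνreg (fun j' l' => hW'b j' l' s hs) hmstar0 (i := j) (n := l)
      (fun j' l' _ => hu'ν j' l' s hs)
    have h2 := gauge_abs_linTermOn_le_of_sup h𝕊 α hνreg (Ψ := W' - W) (MΨ := δD)
      (fun j' l' => by simpa using hδD j' l' s hs) hmstar0 (i := j) (n := l) (fun j' l' _ => hu'ν j' l' s hs)
    have hνpos : 0 < ν j l := hνreg.1 j l
    rw [ef]
    calc ν j l * |linTermOn 𝕊 0 (α' - α) W' u' j l s + linTermOn 𝕊 0 α (W' - W) u' j l s|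
        ≤ ν j l * (|linTermOn 𝕊 0 (α' - α) W' u' j l s| + |linTermOn 𝕊 0 α (W' - W) u' j l s|) :=
          mul_le_mul_of_nonneg_left (abs_add_le _ _) hνpos.le
      _ ≤ 2 * tableAbsSum 𝕊 (α' - α) * M * Λ * mstar + 2 * tableAbsSum 𝕊 α * δD * Λ * mstar := by
          rw [mul_add]; exact add_le_add h1 h2
      _ ≤ F := by
          rw [hF]
          have : 2 * tableAbsSum 𝕊 (α' - α) * M * Λ * mstar ≤ 2 * η * M * Λ * mstar := by gcongr
          nlinarith
  have hec : ∀ j l, ContinuousOn (e j l) (Icc 0 T) := fun j l =>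
    (hu'c j l).sub (continuous_iff_continuousAt.2 fun t => (hud j l t).continuousAt).continuousOn
  have hed : ∀ j l, ∀ s ∈ Ioo 0 T, HasDerivAt (e j l) (linTermOn 𝕊 0 α W e j l s + f j l s) s := by
    intro j l s hs
    have h := (hu' j l s hs).sub (hud j l s)
    refine h.congr_deriv ?_
    have : linTermOn 𝕊 0 α W e j l s = linTermOn 𝕊 0 α W u' j l s - linTermOn 𝕊 0 α W u j l s := by
      have hee : e = u' + (-1 : ℝ) • u := by funext a b c; simp [he]; ring
      rw [hee, linTermOn_add, linTermOn_smul]; ring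
    rw [this, hf]; ring
  have heb : ∀ j l, ∀ s ∈ Icc 0 T, |e j l s| ≤ Mu' + max Mu' 0 * Real.exp (2 * tableAbsSum 𝕊 α * max M 0 * T) :=
    fun j l s hs => (abs_sub _ _).trans (add_le_add (hMu' j l s hs) (hubT j l s hs))
  have he0 : ∀ j l, ν j l * |e j l 0| ≤ 0 := fun j l => by simp [he, hu0]
  have hegauge := gauge_abs_le_forced_exp_Icc h𝕊 α hνreg hWcOn (fun j l t _ => hWb j l t) hfc hff hF0 hec hed heb
    he0 i (k + N) ⟨hT, le_rfl⟩
  rw [zero_add] at hegauge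
  -- (3) the neutral directions of (W', α') versus those of (W, α), in the gauge at the read-out site
  have hνik : ν i (k + N) = ω i k := by simp [hν]
  have hd₂ : ω i k * |W' i (k + N) T - W i (k + N) T| ≤ Δ := by rw [← hνik]; exact hΔ i (k + N)
  have hd₁ : ω i k * |quadTermOn 𝕊 0 α' W' i (k + N) T - quadTermOn 𝕊 0 α W i (k + N) T| ≤
      η * M * Λ * Mν + 2 * tableAbsSum 𝕊 α * M * Λ * Δ := by
    have e1 : quadTermOn 𝕊 0 α' W' i (k + N) T - quadTermOn 𝕊 0 α W i (k + N) T =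
        quadTermOn 𝕊 0 (α' - α) W' i (k + N) T +
          linTermOn 𝕊 0 α ((1 / 2 : ℝ) • (W' + W)) (W' - W) i (k + N) T := by
      rw [← quadTermOn_sub_table, ← quadTermOn_sub_eq_linTermOn_mid]; ring
    have h1 := gauge_abs_quadTermOn_le_of_sup h𝕊 (α' - α) hνreg (fun j l => hW'b j l T ⟨hT, le_rfl⟩) hMν
      (i := i) (n := k + N)
      (fun j l _ => hW'g j l T ⟨hT, le_rfl⟩)
    have hΨb : ∀ j l, |((1 / 2 : ℝ) • (W' + W)) j l T| ≤ M := fun j l => by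
      show |(1 / 2 : ℝ) * (W' j l T + W j l T)| ≤ M
      rw [abs_mul, abs_of_pos (by norm_num : (0 : ℝ) < 1 / 2)]
      linarith [abs_add_le (W' j l T) (W j l T), hW'b j l T ⟨hT, le_rfl⟩, hWb j l T]
    have h2 := gauge_abs_linTermOn_le_of_sup h𝕊 α hνreg hΨb hΔ0 (i := i) (n := k + N)
      (u := W' - W) (fun j l _ => by simpa using hΔ j l)
    have hνpos : 0 < ν i (k + N) := hνreg.1 i (k + N)
    rw [← hνik, e1]
    calc ν i (k + N) * |quadTermOn 𝕊 0 (α' - α) W' i (k + N) T +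
          linTermOn 𝕊 0 α ((1 / 2 : ℝ) • (W' + W)) (W' - W) i (k + N) T|
        ≤ ν i (k + N) * (|quadTermOn 𝕊 0 (α' - α) W' i (k + N) T| +
            |linTermOn 𝕊 0 α ((1 / 2 : ℝ) • (W' + W)) (W' - W) i (k + N) T|) :=
          mul_le_mul_of_nonneg_left (abs_add_le _ _) hνpos.le
      _ ≤ tableAbsSum 𝕊 (α' - α) * M * Λ * Mν + 2 * tableAbsSum 𝕊 α * M * Λ * Δ := by
          rw [mul_add]; exact add_le_add h1 h2
      _ ≤ η * M * Λ * Mν + 2 * tableAbsSum 𝕊 α * M * Λ * Δ := by gcongr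
  -- (4) assemble
  have esplit : u' i (k + N) T - c₁ * quadTermOn 𝕊 0 α' W' i (k + N) T - c₂ * W' i (k + N) T =
      (u i (k + N) T - c₁ * quadTermOn 𝕊 0 α W i (k + N) T - c₂ * W i (k + N) T) + e i (k + N) T -
        c₁ * (quadTermOn 𝕊 0 α' W' i (k + N) T - quadTermOn 𝕊 0 α W i (k + N) T) -
          c₂ * (W' i (k + N) T - W i (k + N) T) := by rw [he]; ring
  rw [esplit]
  have hω0 : 0 ≤ ω i k := (hωpos i k).le
  calc ω i k * |(u i (k + N) T - c₁ * quadTermOn 𝕊 0 α W i (k + N) T - c₂ * W i (k + N) T) + e i (k + N) T -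
        c₁ * (quadTermOn 𝕊 0 α' W' i (k + N) T - quadTermOn 𝕊 0 α W i (k + N) T) -
          c₂ * (W' i (k + N) T - W i (k + N) T)|
      ≤ ω i k * (|u i (k + N) T - c₁ * quadTermOn 𝕊 0 α W i (k + N) T - c₂ * W i (k + N) T| + |e i (k + N) T| +
          |c₁| * |quadTermOn 𝕊 0 α' W' i (k + N) T - quadTermOn 𝕊 0 α W i (k + N) T| +
            |c₂| * |W' i (k + N) T - W i (k + N) T|) := by
        refine mul_le_mul_of_nonneg_left ?_ hω0
        refine (abs_sub _ _).trans (add_le_add ((abs_sub _ _).trans (add_le_add (abs_add_le _ _) ?_)) ?_)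
        · rw [abs_mul]
        · rw [abs_mul]
    _ = ω i k * |u i (k + N) T - c₁ * quadTermOn 𝕊 0 α W i (k + N) T - c₂ * W i (k + N) T| +
          ν i (k + N) * |e i (k + N) T| +
          |c₁| * (ω i k * |quadTermOn 𝕊 0 α' W' i (k + N) T - quadTermOn 𝕊 0 α W i (k + N) T|) +
          |c₂| * (ω i k * |W' i (k + N) T - W i (k + N) T|) := by rw [hνik]; ring
    _ ≤ ρ * B + F * T * Real.exp (2 * tableAbsSum 𝕊 α * M * Λ * T) +
          C * B * (η * M * Λ * Mν + 2 * tableAbsSum 𝕊 α * M * Λ * Δ) + C * B * Δ :=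
        add_le_add (add_le_add (add_le_add (hlinu i k) hegauge)
          (mul_le_mul hc₁ hd₁ (mul_nonneg hω0 (abs_nonneg _)) hC0))
          (mul_le_mul hc₂ hd₂ (mul_nonneg hω0 (abs_nonneg _)) hC0)
    _ = (ρ + (Γ' * (2 * Λ * (η * M + tableAbsSum 𝕊 α * δD)) * Real.exp (2 * tableAbsSum 𝕊 α' * M * Λ * T) * T *
          Real.exp (2 * tableAbsSum 𝕊 α * M * Λ * T) +
          C * (η * M * Λ * Mν + (2 * tableAbsSum 𝕊 α * M * Λ + 1) * Δ))) * B := by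
        rw [hF, hmstar, hL'']; ring

end QuadPolar

end Summit.NavierStokesRegularity.NavierStokesRegularity.Theorems

end
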